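import Literature.Computability.AlgebraicComplexity.GenWordImbalance
import Summits.ValiantsHypothesis.ValiantsHypothesis.Theorems.DepthWindowHomFlatRank
import HarnessLib

/-!
# Route `DepthWindow` — the flat-threshold rank induction over an ARBITRARY word, driven by an imbalance law

Helper file of the route `Theses/DepthWindow.lean` (decomp-valiant workshop, lens 4, generation 10; port plan `PLAN-w2`
§2/F3′: the engine of the Bhargav–Dutta–Saxena column of the slope–rate dial, item `HomImmHardSubReach`).  This is
`DepthWindowHomFlatRank.lean` re-typed over the general word machinery `Literature/…/GenWord*.lean` (size function
`sz : Fin d → ℕ`, signs `pos`, blocks `GenWord.BlockVar sz i`, values `GenWord.InL g P p x`) with ONE change of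
substance: the "type 2" estimate no longer comes from `√2 ∉ ℚ` (`|w_W| ≥ #W·k/(10 θ²)`, LST Claim 16) but from an
IMBALANCE LAW supplied as a hypothesis — at level `p`, every block set `W` with `#W < θ_p` has `#W · κ_p ≤ |w_W|`
(`GenWord.relRank_prod_partition_le_of_law`).  For the BDS word (`+(q₀-p₀)t`, `-q₀ t`) the law is the continued-fraction
inequality `D c_m ≤ 2 b_m |(2a - D) q₀ - a p₀|` of `DepthWindowBDSLaw.lean` with `θ_{m+1} = b_{m+1}/2`,
`κ_{m+1} = t c_m/(2 b_m)`; for the LST word it is Claim 16's `κ_p = k/(10 θ_p²)`.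
Hypotheses of the output `relRank_eval_le_law`: `1 < θ_p`; the law and `0 ≤ κ_p` and the step
`2^{-κ_p θ_{p+1}/2} ≤ ε` for `p < Δ`; rigid constant terms at level `Δ` (`rigid_of_gateValues_gen` derives it from
«all gate values homogeneous»); `productDepth ≤ Δ`; `θ_Δ ≤ d`.  Conclusion: `relrk_{[d]}(g(P)) ≤ (s d^d + 1)^Δ ε`.
Unconditional, 0 sorry, def-free; rung currency only — nothing here bears on `VP ≠ VNP` itself.
References: [LimayeSrinivasanTavenas2025] §5, Claim 16, Lemma 15; [BhargavDuttaSaxena2024] §4.1, Lemma 4.3 / (4.4)–(4.6).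
-/


-- layout Summits/ValiantsHypothesis/ValiantsHypothesis forces the duplicated namespace component
set_option linter.dupNamespace false

namespace Summit.ValiantsHypothesis.ValiantsHypothesis.Theorems.DepthWindow.Law

open MvPolynomial Literature.Computability.AlgebraicComplexity
open Literature.Computability.AlgebraicComplexity.GenWord

noncomputable section

universe u

variable {K : Type u} [Field K]
variable {d : ℕ} {sz : Fin d → ℕ} {pos : Fin d → Bool}
variable {σ₀ : Type} [Fintype σ₀] {blk₀ : σ₀ → Fin d}
variable {g : σ₀ → MvPolynomial (Σ i : Fin d, BlockVar sz i) K} {P : ArithCircuit K σ₀}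

/-- A block-preserving substitution (for any block maps) consists of homogeneous forms of degree `1`.
[cite: LimayeSrinivasanTavenas2025, Lemma 8] -/
theorem isHomogeneous_one_of_isBlockPreserving' {σ τ ι : Type*} {blk : σ → ι} {blk' : τ → ι}
    {f : σ → MvPolynomial τ K} (hf : IsBlockPreserving blk blk' f) (v : σ) : (f v).IsHomogeneous 1 := by
  intro m hm
  have h := hf v hm
  have e1 : Finsupp.weight (1 : τ → ℕ) m = Finsupp.degree m := by
    rw [Finsupp.degree_eq_weight_one]; rfl
  rw [e1, ← Finsupp.degree_mapDomain blk' m, ← weight_blockWeight_eq_mapDomain, h, Finsupp.degree_single]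

omit [Fintype σ₀] in
/-- **Rigidity from the hypothesis of `HomImmHardSubReach`**: if all gate values of `P` are homogeneous and `g` is
block-preserving, every value of every level with a nonzero constant term is a constant (gate values stay homogeneous
along a substitution by linear forms; a homogeneous polynomial with a constant term is constant). [folklore] -/
theorem rigid_of_gateValues_gen (hg : IsBlockPreserving blk₀ Sigma.fst g)
    (hP : ∀ v ∈ ArithCircuit.gateValues P.gates, ∃ e : ℕ, v.IsHomogeneous e) (Δ : ℕ) :
    ∀ x, InL g P Δ x → coeff 0 x ≠ 0 → ∃ c : K, x = C c := by
  have hg1 := isHomogeneous_one_of_isBlockPreserving' hg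
  have hgate : ∀ j : ℕ, ∃ e : ℕ, (aeval g (P.gateVal j)).IsHomogeneous e := by
    intro j
    unfold ArithCircuit.gateVal
    rw [List.getD_eq_getElem?_getD]
    cases hj : (ArithCircuit.gateValues P.gates)[j]? with
    | none => exact ⟨0, by simp [isHomogeneous_zero]⟩
    | some v =>
      obtain ⟨e, he⟩ := hP v (List.mem_of_getElem? hj)
      exact ⟨1 * e, by simpa only [Option.getD_some] using he.aeval g hg1⟩
  rintro x (⟨j, -, rfl⟩ | ⟨v, rfl⟩ | ⟨c, rfl⟩) h0
  · obtain ⟨e, he⟩ := hgate j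
    exact ⟨_, eq_C_of_isHomogeneous_of_coeff_zero_ne he h0⟩
  · exact ⟨_, eq_C_of_isHomogeneous_of_coeff_zero_ne (hg1 v) h0⟩
  · exact ⟨c, rfl⟩

omit [Fintype σ₀] in
/-- A block-linear leaf has `relrk_T = 0` as soon as `#T ≥ 2`. [cite: LimayeSrinivasanTavenas2025, §2.1] -/
theorem relRank_var_eq_zero_gen (hg : IsBlockPreserving blk₀ Sigma.fst g) (v : σ₀)
    {T : Finset (Fin d)} (hT1 : 1 < T.card) : relRank K pos T (g v) = 0 := by
  refine relRank_eq_zero_of_blockLinear sz pos (hg v) fun h => ?_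
  rw [h, Finset.card_singleton] at hT1
  omega

/-- **Sum closure at a fixed block set** `T` with `#T > 1`: if every product gate of product-depth `≤ p` has
`relrk_T ≤ B`, then every gate of product-depth `≤ p` has `relrk_T ≤ s · B` (the leaves contribute `0`).
[cite: LimayeSrinivasanTavenas2025, Claim 16] -/
theorem relRank_gate_le_gen (hg : IsBlockPreserving blk₀ Sigma.fst g) (p : ℕ) {B : ℝ} (hB : 0 ≤ B)
    {T : Finset (Fin d)} (hT1 : 1 < T.card)
    (hprod : ∀ j args, P.gates[j]? = some (.prod args) → P.gatePD j ≤ p →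
      relRank K pos T (aeval g (P.gateVal j)) ≤ B)
    (j : ℕ) (hj : P.gatePD j ≤ p) :
    relRank K pos T (aeval g (P.gateVal j)) ≤ P.size * B := by
  classical
  have hT : T.Nonempty := Finset.card_pos.1 (by omega)
  have hmem : aeval g (P.gateVal j) ∈ Submodule.span K
      (Set.range fun y => aeval g (P.spanFamily p y)) := by
    have h1 := P.span_spanFamily_mono hj (P.gateVal_mem_span_spanFamily j)
    have h2 : aeval g (P.gateVal j) ∈
        Submodule.span K ((aeval g).toLinearMap '' Set.range (P.spanFamily p)) := by
      rw [← Submodule.map_span]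
      exact Submodule.mem_map_of_mem h1
    rwa [← Set.range_comp] at h2
  refine (relRank_le_sum_of_mem_span pos T hmem).trans ?_
  rw [Fintype.sum_sum_type, Fintype.sum_sum_type]
  have h1 : ∑ j' : Fin P.size, relRank K pos T (aeval g (P.spanFamily p (.inl j'))) ≤ P.size * B := by
    calc ∑ j' : Fin P.size, relRank K pos T (aeval g (P.spanFamily p (.inl j')))
        ≤ ∑ _j' : Fin P.size, B := Finset.sum_le_sum fun j' _ => by
          rcases P.spanFamily_inl_eq p j' with h0 | ⟨⟨args, hargs⟩, hpd, heq⟩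
          · rw [h0, map_zero, relRank_zero]; exact hB
          · rw [heq]; exact hprod j' args hargs hpd
      _ = P.size * B := by
          rw [Finset.sum_const, Finset.card_univ, Fintype.card_fin, nsmul_eq_mul]
  have h2 : ∑ v : σ₀, relRank K pos T (aeval g (P.spanFamily p (.inr (.inl v)))) = 0 := by
    refine Finset.sum_eq_zero fun v _ => ?_
    simp only [ArithCircuit.spanFamily, aeval_X]
    exact relRank_var_eq_zero_gen hg v hT1
  have h3 : ∑ u : Unit, relRank K pos T (aeval g (P.spanFamily p (.inr (.inr u)))) = 0 := by
    rw [Fintype.sum_unique]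
    simp only [ArithCircuit.spanFamily, map_one]
    rw [← C_1]
    exact relRank_C_eq_zero sz pos 1 hT
  rw [h2, h3, add_zero, add_zero]
  exact h1

omit [Fintype σ₀] in
/-- **Product gates under an imbalance law** (LST 2025, Claim 16, the two cases, for homogeneous values): if every
value of level `p` has `relrk_{T'} ≤ Λ ε` for `#T' ≥ θ_p`, the constant-full operand values are constants, every
`W` with `#W < θ_p` obeys `#W κ ≤ |w_W|` with `κ ≥ 0`, and `2^{-κ θ_{p+1}/2} ≤ ε`, then a product gate of
product-depth `≤ p + 1` has `relrk_T ≤ d^d Λ ε` for `#T ≥ θ_{p+1}`. [cite: LimayeSrinivasanTavenas2025, Claim 16] -/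
theorem relRank_prodGate_le_law {θ : ℕ → ℝ} {ε Λ κ : ℝ} {p : ℕ} (hΛ : 1 ≤ Λ) (hε : 0 < ε)
    (hIH : ∀ x, InL g P p x → ∀ T : Finset (Fin d), θ p ≤ (T.card : ℝ) →
      relRank K pos T x ≤ Λ * ε)
    (hrig : ∀ x, InL g P p x → coeff 0 x ≠ 0 → ∃ c : K, x = C c)
    (hlaw : ∀ W : Finset (Fin d), (W.card : ℝ) < θ p → (W.card : ℝ) * κ ≤ |(wsum sz pos W : ℝ)|)
    (hκ : 0 ≤ κ) (hstep : (2 : ℝ) ^ (-κ * θ (p + 1) / 2) ≤ ε)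
    {j : ℕ} {args : List (ArithCircuit.Operand K σ₀)}
    (hj : P.gates[j]? = some (.prod args)) (hpd : P.gatePD j ≤ p + 1)
    {T : Finset (Fin d)} (hT : θ (p + 1) ≤ (T.card : ℝ)) (hd : 1 ≤ d) :
    relRank K pos T (aeval g (P.gateVal j)) ≤ (d ^ d : ℕ) * (Λ * ε) := by
  classical
  have hΛε : 0 ≤ Λ * ε := mul_nonneg (by linarith) hε.le
  set L := args.map fun u => aeval g (P.opVal j u) with hLdef
  have hval : aeval g (P.gateVal j) = L.prod := by
    rw [P.gateVal_of_prod hj, map_list_prod, List.map_map]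
    rfl
  have hL : ∀ x ∈ L, InL g P p x := by
    intro x hx
    obtain ⟨u, hu, rfl⟩ := List.mem_map.1 hx
    refine (inL_opVal g P j u).mono ?_
    have := P.opPD_succ_le_gatePD_of_prod hj hu
    omega
  obtain ⟨c₁, hc₁⟩ : ∃ c : K, (unitOps L).prod = C c :=
    exists_list_prod_eq_C _ fun u hu =>
      hrig u (hL u (mem_of_mem_unitOps hu)) (coeff_zero_ne_of_mem_unitOps hu)
  rw [hval, ← relRank_smlProj pos T, prod_eq_zeroOps_prod_mul_unitOps_prod L, hc₁,
    show (zeroOps L).prod * C c₁ = C c₁ * (zeroOps L).prod from mul_comm _ _, smlProj_C_mul]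
  by_cases hz : T.card < (zeroOps L).length
  · rw [smlProj_list_prod_eq_zero_of_card_lt Sigma.fst T (zeroOps L)
      (fun u hu => coeff_zero_of_mem_zeroOps hu) hz, mul_zero, relRank_zero]
    exact mul_nonneg (Nat.cast_nonneg _) hΛε
  · push Not at hz
    obtain ⟨cf, hcf⟩ := exists_smlProj_list_prod_eq_sum Sigma.fst T (zeroOps L)
    have hmem : C c₁ * smlProj Sigma.fst T (zeroOps L).prod ∈
        Submodule.span K (Set.range (partProd Sigma.fst T (zeroOps L))) := by
      rw [MvPolynomial.C_mul', hcf]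
      refine Submodule.smul_mem _ _ (Submodule.sum_mem _ fun a _ => ?_)
      exact Submodule.smul_mem _ _ (Submodule.subset_span ⟨a, rfl⟩)
    refine (relRank_le_sum_of_mem_span pos T hmem).trans ?_
    have hgen : ∀ a : (T → Fin (zeroOps L).length),
        relRank K pos T (partProd Sigma.fst T (zeroOps L) a) ≤ Λ * ε := by
      intro a
      have h := relRank_prod_partition_le_of_law (K := K) sz pos
        (blockPart T a) (fun q => smlProj Sigma.fst (blockPart T a q) (zeroOps L)[q])
        (fun q _ q' _ hne => disjoint_blockPart a hne)
        (fun q => isSetMultilinear_smlProj Sigma.fst _ _) (C := Λ * ε) hlaw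
        (fun q hq => by
          rw [relRank_smlProj pos (blockPart T a q)]
          exact hIH _ (hL _ (mem_of_mem_zeroOps (List.getElem_mem _))) _ hq)
      rw [biUnion_blockPart] at h
      refine h.trans (max_le le_rfl ?_)
      have hsum : (∑ x, ((blockPart T a x).card : ℝ)) = T.card := by
        rw [← Nat.cast_sum, sum_card_blockPart]
      rw [hsum]
      refine le_trans ?_ (hstep.trans (le_mul_of_one_le_left hε.le hΛ))
      refine Real.rpow_le_rpow_of_exponent_le (by norm_num) ?_
      have := mul_le_mul_of_nonneg_left hT hκ
      linarith
    calc ∑ a, relRank K pos T (partProd Sigma.fst T (zeroOps L) a)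
        ≤ ∑ _a : (T → Fin (zeroOps L).length), Λ * ε := Finset.sum_le_sum fun a _ => hgen a
      _ = (Fintype.card (T → Fin (zeroOps L).length) : ℝ) * (Λ * ε) := by
          rw [Finset.sum_const, Finset.card_univ, nsmul_eq_mul]
      _ ≤ (d ^ d : ℕ) * (Λ * ε) := by
          refine mul_le_mul_of_nonneg_right ?_ hΛε
          have hTd : T.card ≤ d := by simpa using Finset.card_le_univ T
          have hcard : Fintype.card (T → Fin (zeroOps L).length) ≤ d ^ d := by
            rw [Fintype.card_fun, Fintype.card_fin, Fintype.card_coe]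
            calc (zeroOps L).length ^ T.card ≤ d ^ T.card := Nat.pow_le_pow_left (hz.trans hTd) _
              _ ≤ d ^ d := Nat.pow_le_pow_right hd hTd
          exact_mod_cast hcard

/-- **One level up** (LST 2025, Claim 16, induction step; flat form with a law): from the bound `Λ ε` at level `p`
above `θ_p` to the bound `(s d^d + 1) Λ ε` at level `p + 1` above `θ_{p+1}`. [cite: LimayeSrinivasanTavenas2025, Claim 16] -/
theorem relRank_le_law_succ (hg : IsBlockPreserving blk₀ Sigma.fst g) {θ : ℕ → ℝ} {ε Λ κ : ℝ} {p : ℕ}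
    (hΛ : 1 ≤ Λ) (hε : 0 < ε)
    (hIH : ∀ x, InL g P p x → ∀ T : Finset (Fin d), θ p ≤ (T.card : ℝ) →
      relRank K pos T x ≤ Λ * ε)
    (hrig : ∀ x, InL g P p x → coeff 0 x ≠ 0 → ∃ c : K, x = C c)
    (hlaw : ∀ W : Finset (Fin d), (W.card : ℝ) < θ p → (W.card : ℝ) * κ ≤ |(wsum sz pos W : ℝ)|)
    (hκ : 0 ≤ κ) (hstep : (2 : ℝ) ^ (-κ * θ (p + 1) / 2) ≤ ε)
    (hθ1 : 1 < θ (p + 1)) (hd : 1 ≤ d) :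
    ∀ x, InL g P (p + 1) x → ∀ T : Finset (Fin d), θ (p + 1) ≤ (T.card : ℝ) →
      relRank K pos T x ≤ ((P.size * d ^ d + 1 : ℕ) : ℝ) * Λ * ε := by
  intro x hx T hT
  have hT2 : 2 ≤ T.card := by
    have h1 : (1 : ℝ) < T.card := hθ1.trans_le hT
    have h2 : 1 < T.card := by exact_mod_cast h1
    omega
  have hT0 : T.Nonempty := Finset.card_pos.1 (by omega)
  have hΛε : 0 ≤ Λ * ε := mul_nonneg (by linarith) hε.le
  have hbound : 0 ≤ ((P.size * d ^ d + 1 : ℕ) : ℝ) * Λ * ε := by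
    rw [mul_assoc]; exact mul_nonneg (Nat.cast_nonneg _) hΛε
  rcases hx with ⟨j, hj, rfl⟩ | ⟨v, rfl⟩ | ⟨c, rfl⟩
  · have hB : (0 : ℝ) ≤ (d ^ d : ℕ) * (Λ * ε) := mul_nonneg (Nat.cast_nonneg _) hΛε
    have h := relRank_gate_le_gen hg (p + 1) hB (by omega)
      (fun j' args hargs hpd => relRank_prodGate_le_law hΛ hε hIH hrig hlaw hκ hstep hargs hpd hT hd) j hj
    refine h.trans ?_
    calc (P.size : ℝ) * ((d ^ d : ℕ) * (Λ * ε))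
        = ((P.size * d ^ d : ℕ) : ℝ) * (Λ * ε) := by push_cast; ring
      _ ≤ ((P.size * d ^ d + 1 : ℕ) : ℝ) * (Λ * ε) := by
          refine mul_le_mul_of_nonneg_right ?_ hΛε
          exact_mod_cast Nat.le_succ _
      _ = _ := by ring
  · rw [relRank_var_eq_zero_gen hg v (by omega)]; exact hbound
  · rw [relRank_C_eq_zero sz pos c hT0]; exact hbound

/-- **All levels** (LST 2025, Claim 16 by induction on the product-depth; flat thresholds, law-driven): with `1 < θ_p`
for all `p`, and for `p < Δ` the law below `θ_p` with constant `κ_p ≥ 0` and `2^{-κ_p θ_{p+1}/2} ≤ ε`, and rigid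
constant terms at level `Δ`, every value of level `p ≤ Δ` has `relrk_T ≤ (s d^d + 1)^p ε` for `#T ≥ θ_p`.
[cite: LimayeSrinivasanTavenas2025, Claim 16] -/
theorem relRank_le_law_all (hg : IsBlockPreserving blk₀ Sigma.fst g) {θ κ : ℕ → ℝ} {ε : ℝ} (hε : 0 < ε)
    (hd : 1 ≤ d) {Δ : ℕ} (hθ1 : ∀ p, 1 < θ p)
    (hlaw : ∀ p, p < Δ → ∀ W : Finset (Fin d), (W.card : ℝ) < θ p →
      (W.card : ℝ) * κ p ≤ |(wsum sz pos W : ℝ)|)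
    (hκ : ∀ p, p < Δ → 0 ≤ κ p)
    (hstep : ∀ p, p < Δ → (2 : ℝ) ^ (-κ p * θ (p + 1) / 2) ≤ ε)
    (hrig : ∀ x, InL g P Δ x → coeff 0 x ≠ 0 → ∃ c : K, x = C c) :
    ∀ p, p ≤ Δ → ∀ x, InL g P p x → ∀ T : Finset (Fin d), θ p ≤ (T.card : ℝ) →
      relRank K pos T x ≤ ((P.size * d ^ d + 1 : ℕ) : ℝ) ^ p * ε := by
  intro p
  induction p with
  | zero =>
    intro _ x hx T hT
    have hT2 : 2 ≤ T.card := by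
      have h1 : (1 : ℝ) < T.card := (hθ1 0).trans_le hT
      have h2 : 1 < T.card := by exact_mod_cast h1
      omega
    have hT0 : T.Nonempty := Finset.card_pos.1 (by omega)
    rw [pow_zero, one_mul]
    rcases hx with ⟨j, hj, rfl⟩ | ⟨v, rfl⟩ | ⟨c, rfl⟩
    · have h := relRank_gate_le_gen (pos := pos) hg 0 (B := 0) le_rfl (T := T) (by omega)
        (fun j' args hargs hpd => absurd (LSTWord.one_le_gatePD_of_prod hargs) (by omega)) j hj
      rw [mul_zero] at h
      exact h.trans hε.le
    · rw [relRank_var_eq_zero_gen hg v (by omega)]; exact hε.le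
    · rw [relRank_C_eq_zero sz pos c hT0]; exact hε.le
  | succ p ih =>
    intro hp x hx T hT
    have hp' : p < Δ := by omega
    have hΛ : (1 : ℝ) ≤ ((P.size * d ^ d + 1 : ℕ) : ℝ) ^ p := by
      refine one_le_pow₀ ?_
      exact_mod_cast Nat.le_add_left 1 _
    have h := relRank_le_law_succ hg hΛ hε (ih hp'.le)
      (fun y hy hy0 => hrig y (hy.mono hp'.le) hy0) (hlaw p hp') (hκ p hp') (hstep p hp') (hθ1 (p + 1)) hd
      x hx T hT
    rw [pow_succ]
    linarith [h]

/-- **The output** (flat, law-driven form of LST 2025, Lemma 15 / Claim 16 for homogeneous circuits): under the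
hypotheses of `relRank_le_law_all` and `θ_Δ ≤ d`, a circuit of product-depth `≤ Δ` satisfies
`relrk_{[d]}(g(P)) ≤ (s d^d + 1)^Δ · ε`. [cite: LimayeSrinivasanTavenas2025, Lemma 15] -/
theorem relRank_eval_le_law (hg : IsBlockPreserving blk₀ Sigma.fst g) {θ κ : ℕ → ℝ} {ε : ℝ} (hε : 0 < ε)
    (hd : 1 ≤ d) {Δ : ℕ} (hθ1 : ∀ p, 1 < θ p)
    (hlaw : ∀ p, p < Δ → ∀ W : Finset (Fin d), (W.card : ℝ) < θ p →
      (W.card : ℝ) * κ p ≤ |(wsum sz pos W : ℝ)|)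
    (hκ : ∀ p, p < Δ → 0 ≤ κ p)
    (hstep : ∀ p, p < Δ → (2 : ℝ) ^ (-κ p * θ (p + 1) / 2) ≤ ε)
    (hrig : ∀ x, InL g P Δ x → coeff 0 x ≠ 0 → ∃ c : K, x = C c)
    (hΔ : P.productDepth ≤ Δ) (hfit : θ Δ ≤ d) :
    relRank K pos Finset.univ (aeval g P.eval) ≤ ((P.size * d ^ d + 1 : ℕ) : ℝ) ^ Δ * ε := by
  have hx : InL g P Δ (aeval g P.eval) := by
    rw [P.eval_eq_opVal_output]
    refine (inL_opVal g P P.size P.output).mono ?_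
    rwa [← P.productDepth_eq_opPD_output]
  refine relRank_le_law_all hg hε hd hθ1 hlaw hκ hstep hrig Δ le_rfl _ hx Finset.univ ?_
  rwa [Finset.card_univ, Fintype.card_fin]

end

end Summit.ValiantsHypothesis.ValiantsHypothesis.Theorems.DepthWindow.Law
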